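import Summits.QuantumFields.YangMills.Theorems.BalabanLadderUVSeamRecCeilingsFarUVWindowCellLaws
import HarnessLib

/-!
# Crux `UVSeamRec` (stmt-QuantumFields-20043), v5(α) stub `stub_responseMomentsOdd6` (RM), lane B: the far-UV window cell laws hold at ALL levels
# `k ≤ K(β)` SIMULTANEOUSLY with SUMMABLE activities, `K(β) → ∞`

Helper file (`--supports stmt-QuantumFields-20043`) of the width-lever seat `ym-20043-ceilings-p2` (lane B, gen 5); sequel of
`…CeilingsFarUVWindowCellLaws` (p563207: at each level `k` the window cell law holds on every odd torus with the explicit activity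
`δ_k(β) = (min 1 (n_k·δ₀(β, θ_k(ε))))^{1/C}`, `C = 16²·19⁴`) and `…CeilingsFarUVSchedule` (p564069: the law in the schedule letters `θ δ : ℝ → ℕ → ℝ`
of a `stub_backgroundFieldWCL`-shaped binder, leaving ONLY the summability `Σ_{1 ≤ k ≤ kmax β R} θ β k ≤ D`).

WHAT IS NEW.  p563207/p564069 control ONE level at a time (`δ_k(β) → 0` as `β → ∞` for each FIXED `k`).  Here the activities are summed:
there is an explicit level count `K(β) = K(𝔟, ε, β) → ∞` (the largest `k ≤ ⌊c₀β⌋` with `b^{4k}·(A + M·k + (D₁/6)·log β) ≤ c₀·β`, where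
`c₀ = min(ε/2, (109824 b² N)⁻²)/12`, `M = 4 log b + 16·C·log 2`, `A = max 0 (log(16·19⁴) + K₀/6)`; so `b^{4K(β)} ≍ β/log β`) such that for
every `β ≥ 1`
  `Σ_{1 ≤ k ≤ K(β)} δ_k(β)^{1/16} ≤ 1`
(`windowCellLaws_summable_farUV`): below the top far-UV level the activities decay super-exponentially, `δ_k(β)^{1/16} ≤ 2^{−k}`.  In the schedule
letters (`largeFieldHalf_schedule_farUV`): for every block size `b ≥ 11` and every threshold schedule with a floor `ε β k ≥ ε₀ > 0` there are
`K : ℝ → ℕ` with `K → ∞` and weights `θ δ : ℝ → ℕ → ℝ`, `0 ≤ θ ≤ 1`, `0 ≤ δ ≤ θ¹⁶`, carrying the window cell laws for all `β ≥ 1`, `L ≥ 1`,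
`k ≥ 1`, AND the summability clause `Σ_{k ∈ (range (kmax β R + 1)).filter (1 ≤ ·)} θ β k ≤ 1` of the v7(β-cl-WCL) candidate VERBATIM for EVERY
cutoff schedule `kmax β R ≤ K β` — i.e. the large-field half `(WCL) ∧ (ΣD)` of such a binder is INHABITED with an unbounded number of levels
(`D = 1`, `β₁ = 1`, any `N`).  The sequel `…CeilingsFarUVReducedEMI` turns this into the reduced (EM_I) with an absolute budget.

HONEST FRAMING: a far-UV rung — `K(β) ≍ ¼·log_b(β/log β)` levels against the `≍ β/ln b` levels up to `R ≍ ℓ₁/a(β)` that (RM) needs; the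
small-field half (split-cl) at cutoff `K(β)` carries all the remaining content; the characteristic scales need Bałaban's R-operation on odd tori
(OPEN).  Nothing of E0′, (split), (GD), NT or the gap; not Clay.  References: T. Bałaban, Commun. Math. Phys. 98 (1985) 17–51 (Prop. 2, via
p559956); folklore real analysis.
-/

set_option autoImplicit false

noncomputable section

open MeasureTheory Filter Topology Finset
open Literature.MathematicalPhysics.QuantumLattice

namespace Summit.QuantumFields.YangMills.Cruxes.UVSeamRec.PolymerRarity

open Summit.QuantumFields.YangMills.Cruxes.OSLegsFromFemtoAndGap.DlrCollarTransfer
open Summit.QuantumFields.YangMills.Cruxes.UVSeamRec.PolymerData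
open Summit.QuantumFields.YangMills.Theorems.OddTorusChessboard (Orient)

/-! ## §1 Arithmetic: the geometric budget -/

section Arithmetic

/-- `Σ_{k=1}^{K} (1/2)^k ≤ 1`. [folklore] -/
theorem sum_Icc_half_pow_le_one (K : ℕ) : ∑ k ∈ Finset.Icc 1 K, (1 / 2 : ℝ) ^ k ≤ 1 := by
  have h : Finset.Icc 1 K = Finset.Ico 1 (K + 1) := by
    ext k; simp only [Finset.mem_Icc, Finset.mem_Ico]; omega
  rw [h]
  refine (geom_sum_Ico_le_of_lt_one (by norm_num) (by norm_num)).trans ?_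
  norm_num

/-- **GEOMETRIC BUDGET.**  If `0 < u k` and `log (u k) ≤ −(log 2/p)·k` for `1 ≤ k ≤ K` (`p > 0`) then `Σ_{k=1}^{K} (min 1 (u k))^p ≤ 1`
(each term is at most `2^{−k}`). [folklore] -/
theorem sum_min_rpow_le_one {p : ℝ} (hp : 0 < p) (u : ℕ → ℝ) (K : ℕ) (hu : ∀ k ∈ Finset.Icc 1 K, 0 < u k)
    (hlog : ∀ k ∈ Finset.Icc 1 K, Real.log (u k) ≤ -(Real.log 2 / p) * k) :
    ∑ k ∈ Finset.Icc 1 K, (min 1 (u k)) ^ p ≤ 1 := by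
  refine (Finset.sum_le_sum fun k hk => ?_).trans (sum_Icc_half_pow_le_one K)
  have hu0 := hu k hk
  have h1 : (min 1 (u k)) ^ p ≤ (u k) ^ p :=
    Real.rpow_le_rpow (le_min zero_le_one hu0.le) (min_le_right _ _) hp.le
  refine h1.trans ?_
  rw [Real.rpow_def_of_pos hu0]
  have h2 : Real.log (u k) * p ≤ (k : ℝ) * (-Real.log 2) := by
    have := mul_le_mul_of_nonneg_right (hlog k hk) hp.le
    calc Real.log (u k) * p ≤ -(Real.log 2 / p) * k * p := this
      _ = (k : ℝ) * (-Real.log 2) := by field_simp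
  calc Real.exp (Real.log (u k) * p) ≤ Real.exp ((k : ℝ) * (-Real.log 2)) := Real.exp_le_exp.2 h2
    _ = (1 / 2 : ℝ) ^ k := by
        rw [Real.exp_nat_mul, Real.exp_neg, Real.exp_log (by norm_num : (0 : ℝ) < 2)]
        norm_num

end Arithmetic

/-! ## §2 The explicit far-UV activity: logarithm and monotonicity in the threshold -/

section Core

/-- `n_k = 16(2ρ_k+1)⁴ ≤ 16·19⁴·b^{4k}` for `b ≥ 11` (from `witnessRadius_bounds`). [folklore] -/
theorem witnessCount_le (𝔟 : BlockSize) (hb : 11 ≤ 𝔟.b) (k : ℕ) :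
    ((16 * (2 * ((8 * 𝔟.b + 2) * ∑ l ∈ Finset.range k, 𝔟.b ^ l + 1) + 1) ^ 4 : ℕ) : ℝ) ≤
      16 * 19 ^ 4 * ((𝔟.b : ℝ) ^ k) ^ 4 := by
  have h := (witnessRadius_bounds 𝔟 hb k).1
  have h' : ((2 * ((8 * 𝔟.b + 2) * ∑ l ∈ Finset.range k, 𝔟.b ^ l + 1) + 1 : ℕ) : ℝ) ≤ 19 * (𝔟.b : ℝ) ^ k := by
    have h2 : (((2 * ((8 * 𝔟.b + 2) * ∑ l ∈ Finset.range k, 𝔟.b ^ l + 1) + 1 : ℕ) : ℤ) : ℝ) ≤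
        ((19 * (𝔟.b : ℤ) ^ k : ℤ) : ℝ) := by
      exact_mod_cast (show ((2 * ((8 * 𝔟.b + 2) * ∑ l ∈ Finset.range k, 𝔟.b ^ l + 1) + 1 : ℕ) : ℤ) ≤
        19 * (𝔟.b : ℤ) ^ k by push_cast at h ⊢; linarith)
    simpa using h2
  have h0 : (0 : ℝ) ≤ ((2 * ((8 * 𝔟.b + 2) * ∑ l ∈ Finset.range k, 𝔟.b ^ l + 1) + 1 : ℕ) : ℝ) := Nat.cast_nonneg _
  have h4 : (((2 * ((8 * 𝔟.b + 2) * ∑ l ∈ Finset.range k, 𝔟.b ^ l + 1) + 1 : ℕ) : ℝ)) ^ 4 ≤ (19 * (𝔟.b : ℝ) ^ k) ^ 4 :=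
    pow_le_pow_left₀ h0 h' 4
  push_cast at h4 ⊢
  nlinarith [h4]

/-- **LOGARITHM OF THE FAR-UV CORE ACTIVITY.**  With `c₀ = min(ε/2, (109824 b² N)⁻²)/12` and `x_k = (b^k)⁴`:
`log (n_k · exp(−βNθ_k(ε)/6 + (K₀ + D₁ log β)/6)) ≤ log(16·19⁴) + K₀/6 + (D₁/6) log β + 4k·log b − β·c₀/x_k` (`b ≥ 11`, `N ≥ 1`). [folklore] -/
theorem log_farUVCore_le (𝔟 : BlockSize) (hb : 11 ≤ 𝔟.b) (N : ℕ) (hN : 0 < N) (ε K₀ : ℝ) (D₁ : ℕ) (β : ℝ) (k : ℕ) :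
    Real.log (((16 * (2 * ((8 * 𝔟.b + 2) * ∑ l ∈ Finset.range k, 𝔟.b ^ l + 1) + 1) ^ 4 : ℕ) : ℝ) *
      Real.exp (-(β * ((N : ℝ) * (min (ε / 2) ((1 / (109824 * (𝔟.b : ℝ) ^ 2 * N)) ^ 2) /
        (2 * N * ((𝔟.b : ℝ) ^ k) ^ 4)))) / Fintype.card (Orient 4) + (K₀ + D₁ * Real.log β) / Fintype.card (Orient 4))) ≤
      Real.log (16 * 19 ^ 4) + K₀ / 6 + (D₁ : ℝ) / 6 * Real.log β + 4 * k * Real.log 𝔟.b -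
        min (ε / 2) ((1 / (109824 * (𝔟.b : ℝ) ^ 2 * N)) ^ 2) / 12 * β / ((𝔟.b : ℝ) ^ k) ^ 4 := by
  rw [show Fintype.card (Orient 4) = 6 from by decide]
  have hb0 : (0 : ℝ) < 𝔟.b := by exact_mod_cast 𝔟.pos
  have hN0 : (0 : ℝ) < N := by exact_mod_cast hN
  have hx0 : (0 : ℝ) < ((𝔟.b : ℝ) ^ k) ^ 4 := by positivity
  set n : ℝ := ((16 * (2 * ((8 * 𝔟.b + 2) * ∑ l ∈ Finset.range k, 𝔟.b ^ l + 1) + 1) ^ 4 : ℕ) : ℝ) with hndef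
  have hn0 : 0 < n := by rw [hndef]; positivity
  rw [Real.log_mul hn0.ne' (Real.exp_pos _).ne', Real.log_exp]
  -- `log n ≤ log(16·19⁴) + 4k log b`
  have hlogn : Real.log n ≤ Real.log (16 * 19 ^ 4) + 4 * k * Real.log 𝔟.b := by
    have h1 : n ≤ 16 * 19 ^ 4 * ((𝔟.b : ℝ) ^ k) ^ 4 := by rw [hndef]; exact witnessCount_le 𝔟 hb k
    have h2 := Real.log_le_log hn0 h1
    rw [Real.log_mul (by norm_num) hx0.ne', Real.log_pow, Real.log_pow] at h2
    push_cast at h2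
    linarith
  -- the exponent, with `#Orient = 6`
  have hexp : -(β * ((N : ℝ) * (min (ε / 2) ((1 / (109824 * (𝔟.b : ℝ) ^ 2 * N)) ^ 2) /
      (2 * N * ((𝔟.b : ℝ) ^ k) ^ 4)))) / ((6 : ℕ) : ℝ) + (K₀ + D₁ * Real.log β) / ((6 : ℕ) : ℝ) =
      K₀ / 6 + (D₁ : ℝ) / 6 * Real.log β -
        min (ε / 2) ((1 / (109824 * (𝔟.b : ℝ) ^ 2 * N)) ^ 2) / 12 * β / ((𝔟.b : ℝ) ^ k) ^ 4 := by
    push_cast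
    field_simp
    ring
  rw [hexp]
  calc Real.log n + (K₀ / 6 + (D₁ : ℝ) / 6 * Real.log β -
        min (ε / 2) ((1 / (109824 * (𝔟.b : ℝ) ^ 2 * N)) ^ 2) / 12 * β / ((𝔟.b : ℝ) ^ k) ^ 4)
      ≤ (Real.log (16 * 19 ^ 4) + 4 * k * Real.log 𝔟.b) + (K₀ / 6 + (D₁ : ℝ) / 6 * Real.log β -
        min (ε / 2) ((1 / (109824 * (𝔟.b : ℝ) ^ 2 * N)) ^ 2) / 12 * β / ((𝔟.b : ℝ) ^ k) ^ 4) := add_le_add hlogn le_rfl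
    _ = _ := by ring

/-- **THE CORE ACTIVITY IS ANTITONE IN THE THRESHOLD**: raising `ε` lowers `n_k · exp(−βNθ_k(ε)/#Orient + (K₀ + D₁ log β)/#Orient)`
(`β ≥ 0`). [folklore] -/
theorem farUVCore_antitone (𝔟 : BlockSize) (N : ℕ) {ε ε' : ℝ} (hεε' : ε ≤ ε') (K₀ : ℝ) (D₁ : ℕ) {β : ℝ} (hβ : 0 ≤ β) (k : ℕ) :
    ((16 * (2 * ((8 * 𝔟.b + 2) * ∑ l ∈ Finset.range k, 𝔟.b ^ l + 1) + 1) ^ 4 : ℕ) : ℝ) *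
      Real.exp (-(β * ((N : ℝ) * (min (ε' / 2) ((1 / (109824 * (𝔟.b : ℝ) ^ 2 * N)) ^ 2) /
        (2 * N * ((𝔟.b : ℝ) ^ k) ^ 4)))) / Fintype.card (Orient 4) + (K₀ + D₁ * Real.log β) / Fintype.card (Orient 4)) ≤
    ((16 * (2 * ((8 * 𝔟.b + 2) * ∑ l ∈ Finset.range k, 𝔟.b ^ l + 1) + 1) ^ 4 : ℕ) : ℝ) *
      Real.exp (-(β * ((N : ℝ) * (min (ε / 2) ((1 / (109824 * (𝔟.b : ℝ) ^ 2 * N)) ^ 2) /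
        (2 * N * ((𝔟.b : ℝ) ^ k) ^ 4)))) / Fintype.card (Orient 4) + (K₀ + D₁ * Real.log β) / Fintype.card (Orient 4)) := by
  refine mul_le_mul_of_nonneg_left (Real.exp_le_exp.2 ?_) (Nat.cast_nonneg _)
  rw [show Fintype.card (Orient 4) = 6 from by decide]
  have hN0 : (0 : ℝ) ≤ N := Nat.cast_nonneg _
  have hx0 : (0 : ℝ) ≤ 2 * N * ((𝔟.b : ℝ) ^ k) ^ 4 := by positivity
  have hmin : min (ε / 2) ((1 / (109824 * (𝔟.b : ℝ) ^ 2 * N)) ^ 2) ≤ min (ε' / 2) ((1 / (109824 * (𝔟.b : ℝ) ^ 2 * N)) ^ 2) :=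
    min_le_min (by linarith) le_rfl
  have h1 : min (ε / 2) ((1 / (109824 * (𝔟.b : ℝ) ^ 2 * N)) ^ 2) / (2 * N * ((𝔟.b : ℝ) ^ k) ^ 4) ≤
      min (ε' / 2) ((1 / (109824 * (𝔟.b : ℝ) ^ 2 * N)) ^ 2) / (2 * N * ((𝔟.b : ℝ) ^ k) ^ 4) :=
    div_le_div_of_nonneg_right hmin hx0
  have h2 : β * ((N : ℝ) * (min (ε / 2) ((1 / (109824 * (𝔟.b : ℝ) ^ 2 * N)) ^ 2) / (2 * N * ((𝔟.b : ℝ) ^ k) ^ 4))) ≤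
      β * ((N : ℝ) * (min (ε' / 2) ((1 / (109824 * (𝔟.b : ℝ) ^ 2 * N)) ^ 2) / (2 * N * ((𝔟.b : ℝ) ^ k) ^ 4))) :=
    mul_le_mul_of_nonneg_left (mul_le_mul_of_nonneg_left h1 hN0) hβ
  have h6 : (0 : ℝ) < ((6 : ℕ) : ℝ) := by norm_num
  have h3 := div_le_div_of_nonneg_right h2 h6.le
  linarith

end Core

/-! ## §3 The far-UV level count `K(β)` and the summability -/

section Level

/-- **SELECTING THE FAR-UV LEVELS.**  `b ≥ 1`, `A, M, D ≥ 0`, any `c₀`; for `β ≥ 1` let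
`K(β) := Nat.findGreatest (fun k => (b^k)⁴·(A + M·k + D·log β) ≤ c₀·β) ⌊c₀ β⌋₊`.  Then for `1 ≤ k ≤ K(β)`:
`A + M·k + D·log β ≤ c₀·β/(b^k)⁴` (the defining inequality at the top level dominates every lower level). [folklore] -/
theorem level_budget_of_le_findGreatest {b : ℕ} (hb : 1 ≤ b) {c₀ A M D : ℝ} (hA : 0 ≤ A) (hM : 0 ≤ M) (hD : 0 ≤ D)
    {β : ℝ} (hβ : 1 ≤ β) {k : ℕ} (hk1 : 1 ≤ k)
    (hkK : k ≤ Nat.findGreatest (fun k : ℕ => ((b : ℝ) ^ k) ^ 4 * (A + M * k + D * Real.log β) ≤ c₀ * β) ⌊c₀ * β⌋₊) :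
    A + M * k + D * Real.log β ≤ c₀ * β / ((b : ℝ) ^ k) ^ 4 := by
  set K := Nat.findGreatest (fun k : ℕ => ((b : ℝ) ^ k) ^ 4 * (A + M * k + D * Real.log β) ≤ c₀ * β) ⌊c₀ * β⌋₊ with hKdef
  have hK0 : K ≠ 0 := by omega
  have hPK : ((b : ℝ) ^ K) ^ 4 * (A + M * K + D * Real.log β) ≤ c₀ * β :=
    Nat.findGreatest_of_ne_zero hKdef.symm hK0
  have hb1 : (1 : ℝ) ≤ b := by exact_mod_cast hb
  have hxk : (1 : ℝ) ≤ ((b : ℝ) ^ k) ^ 4 := one_le_pow₀ (one_le_pow₀ hb1)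
  have hxK : ((b : ℝ) ^ k) ^ 4 ≤ ((b : ℝ) ^ K) ^ 4 :=
    pow_le_pow_left₀ (by positivity) (pow_le_pow_right₀ hb1 hkK) 4
  have hlog : 0 ≤ Real.log β := Real.log_nonneg hβ
  have hkK' : (k : ℝ) ≤ K := by exact_mod_cast hkK
  have hSk : 0 ≤ A + M * k + D * Real.log β := by positivity
  have hSK : A + M * k + D * Real.log β ≤ A + M * K + D * Real.log β := by nlinarith
  rw [le_div_iff₀ (by linarith)]
  calc (A + M * k + D * Real.log β) * ((b : ℝ) ^ k) ^ 4 ≤ (A + M * K + D * Real.log β) * ((b : ℝ) ^ K) ^ 4 :=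
      mul_le_mul hSK hxK (by linarith) (hSk.trans hSK)
    _ ≤ c₀ * β := by rw [mul_comm]; exact hPK

/-- **THE FAR-UV LEVEL COUNT IS UNBOUNDED**: for `c₀ > 0` and `D ≥ 0`, `K(β) → ∞` as `β → ∞` (each fixed level satisfies the defining
inequality for large `β`, since `log β = o(β)`). [folklore] -/
theorem tendsto_findGreatest_level_atTop (b : ℕ) {c₀ : ℝ} (hc₀ : 0 < c₀) (A M : ℝ) {D : ℝ} (hD : 0 ≤ D) :
    Tendsto (fun β : ℝ => Nat.findGreatest (fun k : ℕ => ((b : ℝ) ^ k) ^ 4 * (A + M * k + D * Real.log β) ≤ c₀ * β) ⌊c₀ * β⌋₊)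
      atTop atTop := by
  refine tendsto_atTop.2 fun k₀ => ?_
  set x : ℝ := ((b : ℝ) ^ k₀) ^ 4 with hxdef
  have hx0 : 0 ≤ x := by positivity
  set C₂ : ℝ := x * (A + M * k₀) with hC₂
  set C₃ : ℝ := x * D with hC₃
  have hC₃0 : 0 ≤ C₃ := mul_nonneg hx0 hD
  have hlog : ∀ᶠ β : ℝ in atTop, ‖Real.log β‖ ≤ (c₀ / (2 * (C₃ + 1))) * ‖β‖ :=
    Real.isLittleO_log_id_atTop.bound (by positivity)
  filter_upwards [hlog, eventually_ge_atTop (1 : ℝ), eventually_ge_atTop (2 * |C₂| / c₀), eventually_ge_atTop ((k₀ : ℝ) / c₀)]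
    with β hβlog hβ1 hβC₂ hβk₀
  have hβ0 : 0 ≤ β := by linarith
  rw [Real.norm_eq_abs, Real.norm_eq_abs, abs_of_nonneg (Real.log_nonneg hβ1), abs_of_nonneg hβ0] at hβlog
  refine Nat.le_findGreatest ?_ ?_
  · -- `k₀ ≤ ⌊c₀ β⌋₊`
    refine Nat.le_floor ?_
    rw [div_le_iff₀ hc₀] at hβk₀
    linarith [mul_comm β c₀]
  · -- the defining inequality at level `k₀`
    show x * (A + M * k₀ + D * Real.log β) ≤ c₀ * β
    have h1 : x * (A + M * k₀ + D * Real.log β) = C₂ + C₃ * Real.log β := by rw [hC₂, hC₃]; ring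
    rw [h1]
    have h2 : C₂ ≤ c₀ * β / 2 := by
      rw [div_le_iff₀ hc₀] at hβC₂
      linarith [le_abs_self C₂]
    have h3 : C₃ * Real.log β ≤ c₀ * β / 2 := by
      have h4 : C₃ * Real.log β ≤ C₃ * (c₀ / (2 * (C₃ + 1)) * β) := mul_le_mul_of_nonneg_left hβlog hC₃0
      have h5 : C₃ * (c₀ / (2 * (C₃ + 1)) * β) = (C₃ / (C₃ + 1)) * (c₀ * β / 2) := by field_simp
      have h6 : C₃ / (C₃ + 1) ≤ 1 := by rw [div_le_one (by linarith)]; linarith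
      have h7 : 0 ≤ c₀ * β / 2 := by positivity
      calc C₃ * Real.log β ≤ (C₃ / (C₃ + 1)) * (c₀ * β / 2) := by rw [← h5]; exact h4
        _ ≤ 1 * (c₀ * β / 2) := mul_le_mul_of_nonneg_right h6 h7
        _ = c₀ * β / 2 := one_mul _
    linarith

end Level

/-! ## §4 The window cell laws with summable activities up to level `K(β)` -/

section Summable

variable {N : ℕ} [NeZero N]

/-- **THE FAR-UV WINDOW CELL LAWS HOLD AT ALL LEVELS `k ≤ K(β)` WITH SUMMABLE ACTIVITIES, `K(β) → ∞`.**  For the fundamental Wilson state of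
`SU(N)` (`N ≥ 1`) there are an activity `δ(𝔟, ε, k, β) ∈ [0,1]` — p563207's explicit `(min 1 (n_k·δ₀(β, θ_k(ε))))^{1/C}`, antitone in the
threshold `ε` — and a level count `K(𝔟, ε, β) : ℕ` with `K(𝔟, ε, β) → ∞` as `β → ∞` (each `b ≥ 11`, `ε > 0`) such that
(i) the window cell law `⟨∏_{γ∈A} 1_{largeFieldEvent 𝔟 ε γ}∘lift⟩_{2L+1,β} ≤ ∏_{γ∈A} δ(𝔟, ε, k, β)` holds for every `b ≥ 11`, `ε > 0`, odd torus
(`L ≥ 1`), `β ≥ 1`, level `k` and level-`k` family whose blocks fit in one period window (p563207 verbatim), and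
(ii) `Σ_{1 ≤ k ≤ K(𝔟, ε, β)} δ(𝔟, ε, k, β)^{1/16} ≤ 1` for every `β ≥ 1` (indeed `δ_k^{1/16} ≤ 2^{−k}` below the top far-UV level).
`K` is the largest `k ≤ ⌊c₀β⌋` with `b^{4k}·(A + M·k + (D₁/6) log β) ≤ c₀β`, `c₀ = min(ε/2,(109824 b² N)⁻²)/12`, `M = 4 log b + 16·C·log 2`,
`A = max 0 (log(16·19⁴) + K₀/6)`: `b^{4K(β)} ≍ β/log β`.  [cite: Balaban1985Averaging, Prop. 2 (52)–(54) p.26] -/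
theorem windowCellLaws_summable_farUV :
    ∃ δ : BlockSize → ℝ → ℕ → ℝ → ℝ, ∃ K : BlockSize → ℝ → ℝ → ℕ,
      (∀ 𝔟 ε k β, 0 ≤ δ 𝔟 ε k β ∧ δ 𝔟 ε k β ≤ 1) ∧
      (∀ (𝔟 : BlockSize) (ε ε' : ℝ) (k : ℕ) (β : ℝ), 0 ≤ β → ε ≤ ε' → δ 𝔟 ε' k β ≤ δ 𝔟 ε k β) ∧
      (∀ (𝔟 : BlockSize) (ε : ℝ), 11 ≤ 𝔟.b → 0 < ε → Tendsto (fun β => K 𝔟 ε β) atTop atTop) ∧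
      (∀ (𝔟 : BlockSize) (ε : ℝ), 11 ≤ 𝔟.b → 0 < ε → ∀ β : ℝ, 1 ≤ β →
        ∑ k ∈ Finset.Icc 1 (K 𝔟 ε β), (δ 𝔟 ε k β) ^ ((1 : ℝ) / 16) ≤ 1) ∧
      ∀ (𝔟 : BlockSize), 11 ≤ 𝔟.b → ∀ (ε : ℝ), 0 < ε → ∀ (L : ℕ), 1 ≤ L → ∀ (β : ℝ), 1 ≤ β →
        ∀ (k : ℕ) (o : Fin 4 → ℤ) (A : Finset Polymer), (∀ γ ∈ A, γ.k = k) →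
          (∀ γ ∈ A, ∀ c, o c ≤ anchor 𝔟 γ c ∧ anchor 𝔟 γ c + (𝔟.b : ℤ) ^ k ≤ o c + (2 * L + 1)) →
          torusE (Matrix.specialUnitaryGroup (Fin N) ℂ) (fundamentalLatticeRep N) β L (fun U => ∏ γ ∈ A,
            (largeFieldEvent (N := N) 𝔟 ε γ).indicator (fun _ => (1 : ℝ)) U) ≤ ∏ _γ ∈ A, δ 𝔟 ε k β := by
  obtain ⟨K₀, D₁, hlaw⟩ := torusE_prod_indicator_largeField_le_farUV (N := N)
  have hN : 0 < N := Nat.pos_of_ne_zero (NeZero.ne N)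
  have hN0 : (0 : ℝ) < N := by exact_mod_cast hN
  refine ⟨fun 𝔟 ε k β => (min 1 ((((16 * (2 * ((8 * 𝔟.b + 2) * ∑ l ∈ Finset.range k, 𝔟.b ^ l + 1) + 1) ^ 4 : ℕ) : ℝ) *
          Real.exp (-(β * ((N : ℝ) * (min (ε / 2) ((1 / (109824 * (𝔟.b : ℝ) ^ 2 * N)) ^ 2) /
            (2 * N * ((𝔟.b : ℝ) ^ k) ^ 4)))) / Fintype.card (Orient 4) + (K₀ + D₁ * Real.log β) / Fintype.card (Orient 4))))) ^ ((1 : ℝ) / 33362176),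
    fun 𝔟 ε β => Nat.findGreatest (fun k : ℕ => ((𝔟.b : ℝ) ^ k) ^ 4 *
      (max 0 (Real.log (16 * 19 ^ 4) + K₀ / 6) + (4 * Real.log 𝔟.b + 16 * 33362176 * Real.log 2) * k +
        (D₁ : ℝ) / 6 * Real.log β) ≤ min (ε / 2) ((1 / (109824 * (𝔟.b : ℝ) ^ 2 * N)) ^ 2) / 12 * β)
      ⌊min (ε / 2) ((1 / (109824 * (𝔟.b : ℝ) ^ 2 * N)) ^ 2) / 12 * β⌋₊,
    fun 𝔟 ε k β => ?_, fun 𝔟 ε ε' k β hβ hεε' => ?_, fun 𝔟 ε hb hε => ?_, fun 𝔟 ε hb hε β hβ => ?_,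
    fun 𝔟 hb ε hε L hL β hβ k o A hA hwin => hlaw 𝔟 hb ε hε L hL β hβ k o A hA hwin⟩
  · -- `0 ≤ δ ≤ 1`
    have h0 : 0 ≤ min 1 ((((16 * (2 * ((8 * 𝔟.b + 2) * ∑ l ∈ Finset.range k, 𝔟.b ^ l + 1) + 1) ^ 4 : ℕ) : ℝ) *
          Real.exp (-(β * ((N : ℝ) * (min (ε / 2) ((1 / (109824 * (𝔟.b : ℝ) ^ 2 * N)) ^ 2) /
            (2 * N * ((𝔟.b : ℝ) ^ k) ^ 4)))) / Fintype.card (Orient 4) + (K₀ + D₁ * Real.log β) / Fintype.card (Orient 4)))) := le_min zero_le_one (mul_nonneg (Nat.cast_nonneg _) (Real.exp_pos _).le)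
    exact ⟨Real.rpow_nonneg h0 _, Real.rpow_le_one h0 (min_le_left _ _) (by norm_num)⟩
  · -- antitone in the threshold
    have h0 : 0 ≤ min 1 ((((16 * (2 * ((8 * 𝔟.b + 2) * ∑ l ∈ Finset.range k, 𝔟.b ^ l + 1) + 1) ^ 4 : ℕ) : ℝ) *
          Real.exp (-(β * ((N : ℝ) * (min (ε' / 2) ((1 / (109824 * (𝔟.b : ℝ) ^ 2 * N)) ^ 2) /
            (2 * N * ((𝔟.b : ℝ) ^ k) ^ 4)))) / Fintype.card (Orient 4) + (K₀ + D₁ * Real.log β) / Fintype.card (Orient 4)))) := le_min zero_le_one (mul_nonneg (Nat.cast_nonneg _) (Real.exp_pos _).le)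
    exact Real.rpow_le_rpow h0 (min_le_min le_rfl (farUVCore_antitone 𝔟 N hεε' K₀ D₁ hβ k)) (by norm_num)
  · -- `K → ∞`
    have hc₀ : 0 < min (ε / 2) ((1 / (109824 * (𝔟.b : ℝ) ^ 2 * N)) ^ 2) / 12 := by
      have hb0 : (0 : ℝ) < 𝔟.b := by exact_mod_cast 𝔟.pos
      positivity
    exact tendsto_findGreatest_level_atTop 𝔟.b hc₀ _ _ (by positivity)
  · -- the summability up to level `K(β)`
    have hb0 : (0 : ℝ) < 𝔟.b := by exact_mod_cast 𝔟.pos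
    have hb11 : (11 : ℝ) ≤ 𝔟.b := by exact_mod_cast hb
    have hc₀ : 0 < min (ε / 2) ((1 / (109824 * (𝔟.b : ℝ) ^ 2 * N)) ^ 2) / 12 := by positivity
    have hA : 0 ≤ max 0 (Real.log (16 * 19 ^ 4) + K₀ / 6) := le_max_left _ _
    have hM : 0 ≤ 4 * Real.log 𝔟.b + 16 * 33362176 * Real.log 2 := by
      have h1 : 0 ≤ Real.log 𝔟.b := Real.log_nonneg (by linarith)
      have h2 : 0 ≤ Real.log 2 := Real.log_nonneg (by norm_num)
      positivity
    have hD : 0 ≤ (D₁ : ℝ) / 6 := by positivity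
    -- rewrite `δ^{1/16} = (min 1 u)^{1/(16C)}`
    have hrw : ∀ k : ℕ, ((min 1 ((((16 * (2 * ((8 * 𝔟.b + 2) * ∑ l ∈ Finset.range k, 𝔟.b ^ l + 1) + 1) ^ 4 : ℕ) : ℝ) *
          Real.exp (-(β * ((N : ℝ) * (min (ε / 2) ((1 / (109824 * (𝔟.b : ℝ) ^ 2 * N)) ^ 2) /
            (2 * N * ((𝔟.b : ℝ) ^ k) ^ 4)))) / Fintype.card (Orient 4) + (K₀ + D₁ * Real.log β) / Fintype.card (Orient 4))))) ^ ((1 : ℝ) / 33362176)) ^ ((1 : ℝ) / 16) =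
        (min 1 ((((16 * (2 * ((8 * 𝔟.b + 2) * ∑ l ∈ Finset.range k, 𝔟.b ^ l + 1) + 1) ^ 4 : ℕ) : ℝ) *
          Real.exp (-(β * ((N : ℝ) * (min (ε / 2) ((1 / (109824 * (𝔟.b : ℝ) ^ 2 * N)) ^ 2) /
            (2 * N * ((𝔟.b : ℝ) ^ k) ^ 4)))) / Fintype.card (Orient 4) + (K₀ + D₁ * Real.log β) / Fintype.card (Orient 4))))) ^ ((1 : ℝ) / 33362176 * ((1 : ℝ) / 16)) := fun k =>
      (Real.rpow_mul (le_min zero_le_one (mul_nonneg (Nat.cast_nonneg _) (Real.exp_pos _).le)) _ _).symm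
    simp only [hrw]
    refine sum_min_rpow_le_one (by norm_num) _ _ (fun k _ => mul_pos (by positivity) (Real.exp_pos _)) fun k hk => ?_
    obtain ⟨hk1, hkK⟩ := Finset.mem_Icc.1 hk
    have hbud := level_budget_of_le_findGreatest 𝔟.one_le hA hM hD hβ hk1 hkK
    have hlog := log_farUVCore_le 𝔟 hb N hN ε K₀ D₁ β k
    have hmax : Real.log (16 * 19 ^ 4) + K₀ / 6 ≤ max 0 (Real.log (16 * 19 ^ 4) + K₀ / 6) := le_max_right _ _
    have hgoal : Real.log ((((16 * (2 * ((8 * 𝔟.b + 2) * ∑ l ∈ Finset.range k, 𝔟.b ^ l + 1) + 1) ^ 4 : ℕ) : ℝ) *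
          Real.exp (-(β * ((N : ℝ) * (min (ε / 2) ((1 / (109824 * (𝔟.b : ℝ) ^ 2 * N)) ^ 2) /
            (2 * N * ((𝔟.b : ℝ) ^ k) ^ 4)))) / Fintype.card (Orient 4) + (K₀ + D₁ * Real.log β) / Fintype.card (Orient 4)))) ≤ -(16 * 33362176 * Real.log 2) * k := by linarith
    refine hgoal.trans (le_of_eq ?_)
    congr 1
    field_simp

/-- **THE LARGE-FIELD HALF OF A `stub_backgroundFieldWCL`-SHAPED BINDER IS INHABITED WITH AN UNBOUNDED NUMBER OF LEVELS.**  For every block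
size `b ≥ 11` and every threshold schedule with a floor `ε β k ≥ ε₀ > 0` there are a level count `K : ℝ → ℕ` with `K β → ∞` and weights
`θ δ : ℝ → ℕ → ℝ` with `0 ≤ θ ≤ 1`, `0 ≤ δ ≤ θ¹⁶`, such that (WCL) the window cell laws
`⟨∏_{γ∈A} 1_{largeFieldEvent 𝔟 (ε β k) γ}∘lift⟩_{2L+1,β} ≤ ∏_{γ∈A} δ β k` hold for all `β ≥ 1`, `L ≥ 1`, `k ≥ 1`, window origins and level-`k`
window families (the v7(β-cl-WCL) candidate's clause VERBATIM, `β₁ = 1`), AND (ΣD) for EVERY cutoff schedule `kmax β R ≤ K β`: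
`Σ_{k ∈ (range (kmax β R + 1)).filter (1 ≤ ·)} θ β k ≤ 1` for all `β ≥ 1` and `R` (the candidate's summability clause VERBATIM, `D = 1`).
`θ β k = δ(𝔟, ε₀, k, max β 1)^{1/16}`, `δ β k = δ(𝔟, ε β k, k, max β 1)` from `windowCellLaws_summable_farUV`.  HONEST FRAMING: `K β ≍ ¼log_b β`;
the (split-cl) half at this cutoff carries everything else. [cite: Balaban1985Averaging, Prop. 2 (52)–(54) p.26] -/
theorem largeFieldHalf_schedule_farUV (𝔟 : BlockSize) (hb : 11 ≤ 𝔟.b) (ε : ℝ → ℕ → ℝ) {ε₀ : ℝ} (hε₀ : 0 < ε₀)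
    (hε : ∀ β k, ε₀ ≤ ε β k) :
    ∃ (K : ℝ → ℕ) (θ δ : ℝ → ℕ → ℝ),
      Tendsto K atTop atTop ∧
      (∀ β k, 0 ≤ θ β k) ∧ (∀ β k, θ β k ≤ 1) ∧ (∀ β k, 0 ≤ δ β k) ∧ (∀ β k, δ β k ≤ θ β k ^ 16) ∧
      (∀ β : ℝ, 1 ≤ β → ∀ L : ℕ, 1 ≤ L → ∀ k : ℕ, 1 ≤ k → ∀ (o : Fin 4 → ℤ) (A : Finset Polymer),
        (∀ γ ∈ A, γ.k = k) → (∀ γ ∈ A, ∀ c, o c ≤ anchor 𝔟 γ c ∧ anchor 𝔟 γ c + (𝔟.b : ℤ) ^ k ≤ o c + (2 * L + 1)) →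
        torusE (Matrix.specialUnitaryGroup (Fin N) ℂ) (fundamentalLatticeRep N) β L (fun U => ∏ γ ∈ A,
          (largeFieldEvent (N := N) 𝔟 (ε β k) γ).indicator (fun _ => (1 : ℝ)) U) ≤ ∏ _γ ∈ A, δ β k) ∧
      (∀ kmax : ℝ → ℕ → ℕ, (∀ β R, kmax β R ≤ K β) →
        ∀ β : ℝ, 1 ≤ β → ∀ R : ℕ, ∑ k ∈ (Finset.range (kmax β R + 1)).filter (fun k => 1 ≤ k), θ β k ≤ 1) := by
  obtain ⟨d, K, hd01, hanti, hK, hsum, hlaw⟩ := windowCellLaws_summable_farUV (N := N)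
  refine ⟨fun β => K 𝔟 ε₀ β, fun β k => (d 𝔟 ε₀ k (max β 1)) ^ ((1 : ℝ) / 16), fun β k => d 𝔟 (ε β k) k (max β 1),
    hK 𝔟 ε₀ hb hε₀,
    fun β k => Real.rpow_nonneg (hd01 𝔟 ε₀ k (max β 1)).1 _,
    fun β k => Real.rpow_le_one (hd01 𝔟 ε₀ k (max β 1)).1 (hd01 𝔟 ε₀ k (max β 1)).2 (by norm_num),
    fun β k => (hd01 𝔟 (ε β k) k (max β 1)).1, fun β k => ?_, fun β hβ L hL k _ o A hA hwin => ?_,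
    fun kmax hkmax β hβ R => ?_⟩
  · -- `δ β k ≤ θ β k ^ 16`: antitonicity in the threshold at `max β 1 ≥ 0`, and `(x^{1/16})^16 = x`
    have hβ0 : (0 : ℝ) ≤ max β 1 := zero_le_one.trans (le_max_right _ _)
    refine (hanti 𝔟 ε₀ (ε β k) k (max β 1) hβ0 (hε β k)).trans (le_of_eq ?_)
    rw [← Real.rpow_natCast ((d 𝔟 ε₀ k (max β 1)) ^ ((1 : ℝ) / 16)) 16, ← Real.rpow_mul (hd01 𝔟 ε₀ k (max β 1)).1]
    norm_num
  · -- the window cell law at threshold `ε β k`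
    have hmax : max β 1 = β := max_eq_left hβ
    simp only [hmax]
    exact hlaw 𝔟 hb (ε β k) (hε₀.trans_le (hε β k)) L hL β hβ k o A hA hwin
  · -- the summability for cutoffs `kmax β R ≤ K β`
    have hmax : max β 1 = β := max_eq_left hβ
    simp only [hmax]
    have hsub : (Finset.range (kmax β R + 1)).filter (fun k => 1 ≤ k) ⊆ Finset.Icc 1 (K 𝔟 ε₀ β) := by
      intro k hk
      rw [Finset.mem_filter, Finset.mem_range] at hk
      rw [Finset.mem_Icc]
      exact ⟨hk.2, (Nat.lt_succ_iff.1 hk.1).trans (hkmax β R)⟩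
    exact (Finset.sum_le_sum_of_subset_of_nonneg hsub fun k _ _ => Real.rpow_nonneg (hd01 𝔟 ε₀ k β).1 _).trans
      (hsum 𝔟 ε₀ hb hε₀ β hβ)

end Summable

end Summit.QuantumFields.YangMills.Cruxes.UVSeamRec.PolymerRarity

end
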